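import Literature.NumberTheory.GaloisRepresentations.CyclotomicLevels
import HarnessLib

/-!
# Multi-radical cubic Kummer independence over a field containing `μ₃`, on the Galois side
# (cell `b2b-bsdres`, team n1011, road E-b / sub-target E-b-1 "Kummer independence"; seat p13)

HONEST FRAMING (cell `b2b-bsdres`, run/shared/lean/b2b/bsd-rank1-residual/, verbatim in every
file): the goal of the cell is to DELETE the COMBINATION-SHAPED residual classes of the
Birch–Swinnerton-Dyer formula for ALL analytic-rank `≤ 1` elliptic curves over `ℚ` — "full BSD
formula for every rank `≤ 1` curve in class `C`" assembled STRICTLY from published theorems — so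
that the rank-`≤ 1` remainder becomes exactly the CONSTRUCTION-SHAPED classes, which are TYPED
(missing-input `Prop`s), NOT attempted. This is not "finishing BSD". Team n1011 (N10/N11, the
additive block `X4 ∧ p = 3`): research route on the CONSTRUCTION-SHAPED class X4 / §I N11
(route-1, road E-b); TOOL theorems of Galois theory only (curve-free, `p`-free apart from the
exponent `3`); nothing booked, no mark / label changed; no definition, no named fact, no `sorry`.

## What and why

Road E-b's crux E-b-1 (ROUTE-1 §63.3 / §64.4) asks for an element of `Gal(ℚ̄/ℚ(μ₃))` FIXING the
cube roots of a finite set `B` of naturals and MOVING a primitive ninth root of unity and the cube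
roots of `Δ`.  Its number-theoretic heart is KUMMER INDEPENDENCE for several cube roots at once;
Mathlib has single-radical Kummer theory only (`Mathlib/FieldTheory/KummerExtension.lean`).  This
file proves the multi-radical statement in the form the road consumes — entirely on the GALOIS
SIDE, by induction on the set of radicands, with no degree count, no class number and no
intermediate field: for a subgroup `H ≤ Gal(K̄/K(μ₃))` (`H ≤ rootsOfUnityFixer K 3`), a finite set
`S ⊆ K̄ˣ` of `H`-fixed radicands and an `H`-fixed `c`,

* `exists_prod_pow_mul_cube_of_forall_smul_eq` — **if every `σ ∈ H` fixing all cube roots of all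
  `s ∈ S` fixes the cube roots of `c`, then `c = (∏_{s ∈ S} s^{e_s}) · y³` with `y` FIXED BY `H`**
  (i.e. `c ∈ ⟨S⟩ · (K̄^H)׳`);
* `exists_mem_forall_smul_ne` — contrapositive, the form E-b-1 uses: **if `c ∉ ⟨S⟩ · (K̄^H)׳`
  then some `σ ∈ H` fixes every cube root of every `s ∈ S` and moves EVERY cube root of `c`.**

The induction step is the single-radical descent `exists_fixed_of_cube_fixed_by_stabilizer`: if
`β³` and `y³` are `H`-fixed and `y` is fixed by the stabiliser of `β` in `H`, then
`y³ = (β³)^j · y'³` with `y'` `H`-fixed (`j < 3`) — proved with the Kummer "characters"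
`σ ↦ σ(t)/t ∈ μ₃` (`exists_smul_eq_mul_of_pow_three_eq`) and nothing else.  Helper lemmas:
cube roots of one element differ by cube roots of unity; an element of `Gal(K̄/K(μ₃))` fixing ONE
cube root of `b ≠ 0` fixes all of them, and moving one moves all; powers / products of such
elements act through powers / products of the characters.

References: standard Kummer theory (e.g. Neukirch, *Algebraic Number Theory* IV §3; Lang,
*Algebra* VI §8 Thm. 8.1); cells/n1011/ROUTE-1.md §61.3 (R-v⁺), §63.3 (f), §64.4 (E-b-1 narrowed to
"Kummer independence of `B ∪ {3}` over `ℚ(μ₃)` + a `τ`"); p02 `E-b-1-RV-NOTE.md` gap (G2).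
-/

noncomputable section

open Field
open Literature.NumberTheory.GaloisRepresentations

universe u

namespace Summit.BirchSwinnertonDyer.Rank1Residual.GaloisImage.CubicKummer

variable {K : Type u} [Field K]

/-! ## §1 Cube roots and the Kummer characters `σ ↦ σ(t)/t ∈ μ₃` -/

/-- Two cube roots of the same non-zero element differ by a cube root of unity. [folklore] -/
theorem exists_eq_mul_of_pow_three_eq {t u : AlgebraicClosure K} (ht : t ≠ 0)
    (h : u ^ 3 = t ^ 3) : ∃ w : AlgebraicClosure K, w ^ 3 = 1 ∧ u = w * t := by
  refine ⟨u / t, ?_, (div_mul_cancel₀ u ht).symm⟩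
  rw [div_pow, h, div_self (pow_ne_zero 3 ht)]

/-- **The Kummer character.** If `σ ∈ Γ_K` fixes `c` and `t³ = c` then `σ t = w · t` for a cube
root of unity `w`. [folklore] -/
theorem exists_smul_eq_mul_of_pow_three_eq (σ : absoluteGaloisGroup K) {c t : AlgebraicClosure K}
    (hc : σ • c = c) (ht : t ^ 3 = c) :
    ∃ w : AlgebraicClosure K, w ^ 3 = 1 ∧ σ • t = w * t := by
  by_cases h0 : t = 0
  · exact ⟨1, one_pow 3, by rw [h0, smul_zero, mul_zero]⟩
  · refine exists_eq_mul_of_pow_three_eq h0 ?_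
    rw [← smul_pow', ht, hc]

/-- An element of `Gal(K̄/K(μ₃))` fixing ONE cube root `β` of `b ≠ 0` fixes EVERY cube root of `b`.
[folklore] -/
theorem smul_eq_self_of_pow_three_eq {σ : absoluteGaloisGroup K} (hσ : σ ∈ rootsOfUnityFixer K 3)
    {β t : AlgebraicClosure K} (hβ : β ≠ 0) (hσβ : σ • β = β) (ht : t ^ 3 = β ^ 3) :
    σ • t = t := by
  obtain ⟨w, hw, rfl⟩ := exists_eq_mul_of_pow_three_eq hβ ht
  rw [smul_mul', hσβ, mem_rootsOfUnityFixer_iff.mp hσ w hw]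

/-- An element of `Gal(K̄/K(μ₃))` moving ONE cube root of `c ≠ 0` moves EVERY cube root of `c`.
[folklore] -/
theorem smul_ne_self_of_pow_three_eq {σ : absoluteGaloisGroup K} (hσ : σ ∈ rootsOfUnityFixer K 3)
    {c t₀ t : AlgebraicClosure K} (hc : c ≠ 0) (ht₀ : t₀ ^ 3 = c) (hne : σ • t₀ ≠ t₀)
    (ht : t ^ 3 = c) : σ • t ≠ t := by
  intro h
  have ht0 : t ≠ 0 := by
    rintro rfl
    exact hc (by rw [← ht]; norm_num)
  exact hne (smul_eq_self_of_pow_three_eq hσ ht0 h (by rw [ht₀, ht]))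

/-- Powers act through powers of the character: `σ t = w t`, `σ w = w` ⟹ `σ^k t = w^k t`.
[folklore] -/
theorem pow_smul_eq_pow_mul {σ : absoluteGaloisGroup K} {w t : AlgebraicClosure K}
    (hσw : σ • w = w) (h : σ • t = w * t) (k : ℕ) : σ ^ k • t = w ^ k * t := by
  induction k with
  | zero => rw [pow_zero, one_smul, pow_zero, one_mul]
  | succ k ih =>
    have hwk : σ ^ k • w = w := by
      clear ih
      induction k with
      | zero => rw [pow_zero, one_smul]
      | succ k ih => rw [pow_succ, mul_smul, hσw, ih]
    rw [pow_succ, mul_smul, h, smul_mul', hwk, ih, pow_succ]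
    ring

/-- If `σ` fixes `t` then so does every power of `σ`. [folklore] -/
theorem pow_smul_eq_self {σ : absoluteGaloisGroup K} {t : AlgebraicClosure K} (h : σ • t = t)
    (k : ℕ) : σ ^ k • t = t := by
  have := pow_smul_eq_pow_mul (w := 1) (smul_one σ) (by rw [one_mul]; exact h) k
  rwa [one_pow, one_mul] at this

/-- A cube root of unity other than `1` is a primitive cube root of unity (`3` is prime).
[folklore] -/
theorem isPrimitiveRoot_of_pow_three_eq_one_of_ne_one {w : AlgebraicClosure K} (hw : w ^ 3 = 1)
    (hw1 : w ≠ 1) : IsPrimitiveRoot w 3 := by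
  have h := orderOf_eq_prime (p := 3) hw hw1
  rw [← h]
  exact IsPrimitiveRoot.orderOf w

/-! ## §2 The single-radical descent -/

/-- If two elements `σ, ρ ∈ H` agree on `β`, they agree on every `y` fixed by the stabiliser of
`β` in `H`. [folklore] -/
theorem smul_eq_smul_of_smul_eq_smul {H : Subgroup (absoluteGaloisGroup K)}
    {β y : AlgebraicClosure K} (hy : ∀ σ ∈ H, σ • β = β → σ • y = y)
    {σ ρ : absoluteGaloisGroup K} (hσ : σ ∈ H) (hρ : ρ ∈ H) (h : σ • β = ρ • β) :
    σ • y = ρ • y := by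
  have h1 : (ρ⁻¹ * σ) • β = β := by rw [mul_smul, h, inv_smul_smul]
  have h2 := hy (ρ⁻¹ * σ) (H.mul_mem (H.inv_mem hρ) hσ) h1
  rw [mul_smul, inv_smul_eq_iff] at h2
  exact h2

/-- **Single-radical descent (the induction step of Kummer independence).**  Let
`H ≤ Gal(K̄/K(μ₃))`, `β ∈ K̄ˣ` with `β³` fixed by `H`, and `y ∈ K̄` with `y³` fixed by `H` and `y`
fixed by the stabiliser of `β` in `H` (i.e. "`y ∈ K̄^H(β)`").  Then `y³ = (β³)^j · y'³` for some
`j < 3` and some `y'` FIXED BY `H` — i.e. `K̄^H(∛b) ∩ ∛(K̄^H) ⊆ ∛(⟨b⟩ (K̄^H)׳)`.  Proof: if `H`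
fixes `β` take `j = 0`; otherwise pick `σ₀ ∈ H` with `σ₀ β = u₀ β`, `u₀ ≠ 1` a primitive cube root
of unity, write `σ₀ y = u₀^j y`, and put `y' = y / β^j`: every `σ ∈ H` acts on `β` as some
`σ₀^k`, hence (by `smul_eq_smul_of_smul_eq_smul`) on `y` as `σ₀^k`, so `σ y' = σ₀^k y' = y'`.
[folklore] -/
theorem exists_fixed_of_cube_fixed_by_stabilizer {H : Subgroup (absoluteGaloisGroup K)}
    (hH : H ≤ rootsOfUnityFixer K 3) {β : AlgebraicClosure K} (hβ : β ≠ 0)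
    (hbH : ∀ σ ∈ H, σ • (β ^ 3) = β ^ 3) {y : AlgebraicClosure K}
    (hy : ∀ σ ∈ H, σ • β = β → σ • y = y) (hdH : ∀ σ ∈ H, σ • (y ^ 3) = y ^ 3) :
    ∃ j < 3, ∃ y' : AlgebraicClosure K, (∀ σ ∈ H, σ • y' = y') ∧
      y ^ 3 = (β ^ 3) ^ j * y' ^ 3 := by
  classical
  by_cases hfix : ∀ σ ∈ H, σ • β = β
  · exact ⟨0, by norm_num, y, fun σ hσ => hy σ hσ (hfix σ hσ), by rw [pow_zero, one_mul]⟩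
  push Not at hfix
  obtain ⟨σ₀, hσ₀H, hσ₀β⟩ := hfix
  have hσ₀μ : σ₀ ∈ rootsOfUnityFixer K 3 := hH hσ₀H
  -- the character values of `σ₀` on `β` and on `y`
  obtain ⟨u₀, hu₀, hσ₀u⟩ := exists_smul_eq_mul_of_pow_three_eq σ₀ (hbH σ₀ hσ₀H) rfl
  have hu₀1 : u₀ ≠ 1 := fun h => hσ₀β (by rw [hσ₀u, h, one_mul])
  have hprim : IsPrimitiveRoot u₀ 3 := isPrimitiveRoot_of_pow_three_eq_one_of_ne_one hu₀ hu₀1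
  obtain ⟨v₀, hv₀, hσ₀v⟩ := exists_smul_eq_mul_of_pow_three_eq σ₀ (hdH σ₀ hσ₀H) rfl
  haveI : NeZero (3 : ℕ) := ⟨by norm_num⟩
  obtain ⟨j, hj, hv₀j⟩ := hprim.eq_pow_of_pow_eq_one hv₀
  have hσ₀u₀ : σ₀ • u₀ = u₀ := mem_rootsOfUnityFixer_iff.mp hσ₀μ u₀ hu₀
  refine ⟨j, hj, y / β ^ j, fun σ hσH => ?_, ?_⟩
  · -- `σ` acts on `β` as `σ₀^k`
    obtain ⟨u, hu, hσu⟩ := exists_smul_eq_mul_of_pow_three_eq σ (hbH σ hσH) rfl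
    obtain ⟨k, -, huk⟩ := hprim.eq_pow_of_pow_eq_one hu
    have hρβ : σ₀ ^ k • β = u₀ ^ k * β := pow_smul_eq_pow_mul hσ₀u₀ hσ₀u k
    have hρy : σ₀ ^ k • y = v₀ ^ k * y := by
      refine pow_smul_eq_pow_mul ?_ hσ₀v k
      rw [← hv₀j, smul_pow', hσ₀u₀]
    have hagree : σ • β = σ₀ ^ k • β := by rw [hσu, hρβ, huk]
    have hyagree : σ • y = σ₀ ^ k • y :=
      smul_eq_smul_of_smul_eq_smul hy hσH (H.pow_mem hσ₀H k) hagree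
    rw [smul_div₀', hyagree, smul_pow', hagree, hρy, hρβ, ← hv₀j, mul_pow, ← pow_mul, ← pow_mul,
      mul_comm j k, mul_div_mul_left _ _ (pow_ne_zero _ (hprim.ne_zero (by norm_num)))]
  · rw [div_pow, ← pow_mul, ← pow_mul, mul_comm j 3, mul_div_assoc',
      mul_div_cancel_left₀ _ (pow_ne_zero _ hβ)]

/-! ## §3 Kummer independence for finitely many cube roots -/

/-- **Multi-radical cubic Kummer independence (Galois form).**  Let `H ≤ Gal(K̄/K(μ₃))`, `S` a
finite set of non-zero `H`-fixed radicands and `c` an `H`-fixed element.  If every `σ ∈ H` that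
fixes all cube roots of all `s ∈ S` fixes the cube roots of `c`, then
`c = (∏_{s ∈ S} s^{e_s}) · y³` with `y` fixed by `H` — "`∛c ∈ K̄^H(∛S) ⟹ c ∈ ⟨S⟩ · (K̄^H)׳`".
By induction on `S` (`exists_fixed_of_cube_fixed_by_stabilizer` is the step, applied to the
stabiliser `H ∩ Stab(∛b)` of one new cube root). [folklore] -/
theorem exists_prod_pow_mul_cube_of_forall_smul_eq {H : Subgroup (absoluteGaloisGroup K)}
    (hH : H ≤ rootsOfUnityFixer K 3) (S : Finset (AlgebraicClosure K))
    (hS : ∀ s ∈ S, s ≠ 0 ∧ ∀ σ ∈ H, σ • s = s) {c : AlgebraicClosure K}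
    (hcH : ∀ σ ∈ H, σ • c = c)
    (hfix : ∀ σ ∈ H, (∀ s ∈ S, ∀ t : AlgebraicClosure K, t ^ 3 = s → σ • t = t) →
      ∀ t : AlgebraicClosure K, t ^ 3 = c → σ • t = t) :
    ∃ (e : AlgebraicClosure K → ℕ) (y : AlgebraicClosure K), (∀ σ ∈ H, σ • y = y) ∧
      c = (∏ s ∈ S, s ^ e s) * y ^ 3 := by
  classical
  induction S using Finset.induction_on generalizing H with
  | empty =>
    obtain ⟨γ, hγ⟩ := IsAlgClosed.exists_pow_nat_eq c (by norm_num : 0 < 3)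
    exact ⟨fun _ => 0, γ, fun σ hσ => hfix σ hσ (by simp) γ hγ,
      by rw [Finset.prod_empty, one_mul, hγ]⟩
  | @insert b S₀ hb ih =>
    obtain ⟨hb0, hbH⟩ := hS b (Finset.mem_insert_self b S₀)
    obtain ⟨β, hβ⟩ := IsAlgClosed.exists_pow_nat_eq b (by norm_num : 0 < 3)
    have hβ0 : β ≠ 0 := by
      rintro rfl
      exact hb0 (by rw [← hβ]; norm_num)
    -- the stabiliser of `β` in `H`
    set H₁ : Subgroup (absoluteGaloisGroup K) := H ⊓ MulAction.stabilizer (absoluteGaloisGroup K) β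
      with hH₁
    have hH₁le : H₁ ≤ H := inf_le_left
    have hH₁β : ∀ σ ∈ H₁, σ • β = β := fun σ hσ => MulAction.mem_stabilizer_iff.mp hσ.2
    obtain ⟨e, y, hyH₁, hc⟩ := ih (H := H₁) (hH₁le.trans hH) (fun s hs =>
        ⟨(hS s (Finset.mem_insert_of_mem hs)).1,
          fun σ hσ => (hS s (Finset.mem_insert_of_mem hs)).2 σ (hH₁le hσ)⟩)
      (fun σ hσ => hcH σ (hH₁le hσ)) (fun σ hσ hσS => hfix σ (hH₁le hσ) (fun s hs t ht => by
        rcases Finset.mem_insert.mp hs with rfl | hs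
        · exact smul_eq_self_of_pow_three_eq (hH (hH₁le hσ)) hβ0 (hH₁β σ hσ) (by rw [ht, hβ])
        · exact hσS s hs t ht))
    -- the product over `S₀` is `H`-fixed and non-zero
    set P : AlgebraicClosure K := ∏ s ∈ S₀, s ^ e s with hP
    have hP0 : P ≠ 0 := Finset.prod_ne_zero_iff.mpr fun s hs =>
      pow_ne_zero _ (hS s (Finset.mem_insert_of_mem hs)).1
    have hPH : ∀ σ ∈ H, σ • P = P := fun σ hσ => by
      rw [hP, Finset.smul_prod']
      exact Finset.prod_congr rfl fun s hs => by
        rw [smul_pow', (hS s (Finset.mem_insert_of_mem hs)).2 σ hσ]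
    have hy3 : y ^ 3 = c / P := by
      rw [eq_div_iff hP0, mul_comm, ← hc]
    -- single-radical descent from `H₁` to `H`
    obtain ⟨j, -, y', hy'H, hyj⟩ := exists_fixed_of_cube_fixed_by_stabilizer hH hβ0
      (fun σ hσ => by rw [hβ]; exact hbH σ hσ)
      (fun σ hσ hσβ => hyH₁ σ ⟨hσ, MulAction.mem_stabilizer_iff.mpr hσβ⟩)
      (fun σ hσ => by rw [hy3, smul_div₀', hcH σ hσ, hPH σ hσ])
    refine ⟨Function.update e b j, y', hy'H, ?_⟩
    rw [Finset.prod_insert hb, Function.update_self,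
      Finset.prod_congr rfl fun s hs => by rw [Function.update_of_ne (ne_of_mem_of_not_mem hs hb)],
      ← hP, ← hβ]
    calc c = P * y ^ 3 := hc
      _ = P * ((β ^ 3) ^ j * y' ^ 3) := by rw [hyj]
      _ = (β ^ 3) ^ j * P * y' ^ 3 := by ring

/-- **Kummer independence, the form E-b-1 consumes.**  `H ≤ Gal(K̄/K(μ₃))`, `S` a finite set of
non-zero `H`-fixed radicands, `c ≠ 0` `H`-fixed with `c ∉ ⟨S⟩ · (K̄^H)׳`.  Then SOME `σ ∈ H`
fixes every cube root of every `s ∈ S` and moves EVERY cube root of `c`. [folklore] -/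
theorem exists_mem_forall_smul_ne {H : Subgroup (absoluteGaloisGroup K)}
    (hH : H ≤ rootsOfUnityFixer K 3) (S : Finset (AlgebraicClosure K))
    (hS : ∀ s ∈ S, s ≠ 0 ∧ ∀ σ ∈ H, σ • s = s) {c : AlgebraicClosure K} (hc : c ≠ 0)
    (hcH : ∀ σ ∈ H, σ • c = c)
    (hnot : ∀ (e : AlgebraicClosure K → ℕ) (y : AlgebraicClosure K), (∀ σ ∈ H, σ • y = y) →
      c ≠ (∏ s ∈ S, s ^ e s) * y ^ 3) :
    ∃ σ ∈ H, (∀ s ∈ S, ∀ t : AlgebraicClosure K, t ^ 3 = s → σ • t = t) ∧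
      ∀ t : AlgebraicClosure K, t ^ 3 = c → σ • t ≠ t := by
  by_contra h
  push Not at h
  obtain ⟨e, y, hyH, hcy⟩ := exists_prod_pow_mul_cube_of_forall_smul_eq hH S hS hcH
    (fun σ hσ hσS t ht => by
      obtain ⟨t₀, ht₀, hσt₀⟩ := h σ hσ hσS
      have ht₀0 : t₀ ≠ 0 := by
        rintro rfl
        exact hc (by rw [← ht₀]; norm_num)
      exact smul_eq_self_of_pow_three_eq (hH hσ) ht₀0 hσt₀ (by rw [ht, ht₀]))
  exact hnot e y hyH hcy

end Summit.BirchSwinnertonDyer.Rank1Residual.GaloisImage.CubicKummer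

end
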